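import Summits.HubbardSuperconductivity.HubbardSuperconductivity.Theorems.AnisotropyChordTransferFibre3FinXDSideZ

/-!
# Route `AnisotropyChord` / H0 rotor rung: FIN per-`L` SIDE-CONDITION cell facts, `L = 10` (GM₃ cells 210–217)

Kernel facts `sdCellAnyZ 10 (49/50) 20 la lb (c, bn, aD) = true` (regime clause `mHole ≥ 0 ∧ facMI·η·(aD + b/(2+cos θ)) < c` on the cell, or vacuity), g5's `xbEval` objects, `decide +kernel`.
Prover seat `hubbard-h0-rotor-p3` g7; helper for piece A = stmt-HubbardSuperconductivity-23918 of rung 19089 (`--supports`, helper class).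
WHAT THIS IS NOT: nothing here proves superconductivity in the Hubbard model (rotor TARGET as worded stays FALSE, g15 verdict); kernel facts /
assembly for ONE conditional reduction at one `L`.  No sorry.
-/

set_option linter.dupNamespace false
set_option autoImplicit false

namespace Summit.HubbardSuperconductivity.HubbardSuperconductivity.Theorems.AnisotropyChord.Transfer.Fibre3

namespace FinXD

/-- side-condition cell `[25227682253283585, 25530414440322989]` of `L = 10` (`cert`). [folklore] -/
theorem sd10_210 : sdCellAnyZ 10 (49/50 : ℚ) 20 25227682253283585 25530414440322989 ((9/20 : ℚ), (27 : ℕ), (1/20 : ℚ)) = true := by decide +kernel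

/-- side-condition cell `[25530414440322989, 25836779413606865]` of `L = 10` (`cert`). [folklore] -/
theorem sd10_211 : sdCellAnyZ 10 (49/50 : ℚ) 20 25530414440322989 25836779413606865 ((9/20 : ℚ), (28 : ℕ), (1/20 : ℚ)) = true := by decide +kernel

/-- side-condition cell `[25836779413606865, 26146820766570149]` of `L = 10` (`cert`). [folklore] -/
theorem sd10_212 : sdCellAnyZ 10 (49/50 : ℚ) 20 25836779413606865 26146820766570149 ((9/20 : ℚ), (28 : ℕ), (1/20 : ℚ)) = true := by decide +kernel

/-- side-condition cell `[26146820766570149, 26460582615768993]` of `L = 10` (`cert`). [folklore] -/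
theorem sd10_213 : sdCellAnyZ 10 (49/50 : ℚ) 20 26146820766570149 26460582615768993 ((9/20 : ℚ), (28 : ℕ), (1/20 : ℚ)) = true := by decide +kernel

/-- side-condition cell `[26460582615768993, 26778109607158221]` of `L = 10` (`cert`). [folklore] -/
theorem sd10_214 : sdCellAnyZ 10 (49/50 : ℚ) 20 26460582615768993 26778109607158221 ((9/20 : ℚ), (29 : ℕ), (1/20 : ℚ)) = true := by decide +kernel

/-- side-condition cell `[26778109607158221, 27099446922444121]` of `L = 10` (`cert`). [folklore] -/
theorem sd10_215 : sdCellAnyZ 10 (49/50 : ℚ) 20 26778109607158221 27099446922444121 ((9/20 : ℚ), (29 : ℕ), (1/20 : ℚ)) = true := by decide +kernel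

/-- side-condition cell `[27099446922444121, 40649170383666177]` of `L = 10` (`num`). [folklore] -/
theorem sd10_216 : sdCellAnyZ 10 (49/50 : ℚ) 20 27099446922444121 40649170383666177 ((1 : ℚ), (1 : ℕ), (1 : ℚ)) = true := by decide +kernel

/-- side-condition cell `[40649170383666177, 44696237324682760]` of `L = 10` (`num`). [folklore] -/
theorem sd10_217 : sdCellAnyZ 10 (49/50 : ℚ) 20 40649170383666177 44696237324682760 ((1 : ℚ), (1 : ℕ), (1 : ℚ)) = true := by decide +kernel

end FinXD

end Summit.HubbardSuperconductivity.HubbardSuperconductivity.Theorems.AnisotropyChord.Transfer.Fibre3
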